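import Summits.BirchSwinnertonDyer.BirchSwinnertonDyer.Theorems.ByReductionTypeAtTwoFineSelmerConjAAtTwoAdditivePotGoodHeart
import Summits.BirchSwinnertonDyer.BirchSwinnertonDyer.Theorems.ByReductionTypeAtTwoOrdKatoHalfAtTwoIsoOptimalOff514OptimalMember
import Literature.NumberTheory.EllipticCurves.ModularCurvePeriodRatioTwoProofs
import HarnessLib

/-!
# Route ByReductionTypeAtTwo, crux `OrdKatoHalfAtTwoIso` (stmt-BirchSwinnertonDyer-19573), child B7′
# (stmt-BirchSwinnertonDyer-23921): Coates–Sujatha's statement (A) at `2` — «`Sel₀(E/ℚ_∞, E[2^∞])[2]` finite» — is PRINT BY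
# NAME on the WHOLE habitat of B7′ («`ρ̄_{W,2}` NOT onto»), through the tree's abelian-`2`-division-field road
# (theorems only; the two named facts displayed)

Seat `cruxlead-stmt-BirchSwinnertonDyer-19573-w2` GEN 3 (prover WIDTH under LEAD cruxlead-19573 g5; HOME
`run/shared/lean/pub/bsd-2adic/`; `--supports` stmt-BirchSwinnertonDyer-23921). HONEST FRAMING (cell bsd-2adic): BSD is not proved by
any of this; neither the crux nor B7′ is proved here; THEOREMS ONLY, CONDITIONAL on two PUBLISHED facts by name — `hLim2` = Lim
2017 Thm. 3.5 at `p = 2` (`Lim2017.thm35_at_two_fineSelmerDual_moduleFinite_of_classicalMuVanishes_of_le_divisionField_four`, used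
on its honest totally imaginary carrier `ℚ(E[2], √−1)` by the tree theorem cited below) and `hFW` = Ferrero–Washington
(`IwasawaTheory.ferreroWashington1979_classicalMuVanishes`).

WHY THIS FILE. The `μ`-doors of this lane (`…OrdKatoHalfAtTwoIsoIrrMuDoor`, `…OrdKatoHalfAtTwoIsoOptimalMemberMuDoor`) reduce B7′
to a span-free Coleman `μ`-package AND the binder (A₂) «`Set.Finite {s : W.fineSelmerInfty κ | 2 • s = 0}`» (statement (A) at
`2` in Greenberg's `Sel₀[p]`-form) on the habitat «`ρ̄_{W,2}` NOT onto». That binder is ALREADY a theorem of the tree modulo print,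
assembled here BY NAME in the doors' currency: `ρ̄_{W,2}` not onto ⟺ `ℚ(E[2])/ℚ` abelian
(`AddKatoTwo.not_isAbelianGalois_divisionField_two_iff_hasSurjectiveModNGaloisRep`, Dokchitser–Dokchitser + `S₃`) ⟹ statement (A)
at `(W, 2)` in the `∃ γ D` form (`AddKatoTwo.conjA_two_of_isAbelianGalois_divisionField_two`, cell seat addL2x GEN 9: Lim@2 on
`ℚ(E[2], i) ≤ ℚ(E[4])` of `2`-power index, Ferrero–Washington for the abelian field `ℚ(E[2], i)`) ⟹ `Sel₀(E/ℚ_∞)[2]` finite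
(`finite_pTorsion_of_fineSelmerDualData_moduleFinite`, Pontryagin duality). So MEMO-7's Props. 2.3/2.4 (the cell memo's
Weber/Ferrero–Washington computation of the residual fine Selmer groups for reducible and `C₃` images) are COVERED BY PRINT, and the
only beyond-print binder left in B7′ after this lane is the Coleman `μ`-package (Kato's zeta / half classes in Coleman
coordinates at `2`).

* `finite_fineSelmerInfty_twoTorsion_of_not_hasSurjectiveModNGaloisRep` — (A₂) at one curve with `ρ̄₂` not onto.
* `conjATwo_C3_habitat` — the (A₂-C₃) binder of `…IrrMuDoor` VERBATIM, from `hLim2`, `hFW`.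
* `not_hasSurjectiveModNGaloisRep_two_of_isIsogenous_of_not_irreducible` — `E[2]` reducible is isogeny-invariant
  (`Rank1Residual.not_hasIrreducibleModPGaloisRep_of_isIsogenous`), so an isogenous member of a reducible curve is not
  surjective either; hence `conjATwo_reducible_optimal_habitat` — the (A₂-opt) binder of `…OptimalMemberMuDoor` RESTRICTED TO THE
  REDUCIBLE PART, verbatim, from `hLim2`, `hFW`. (On the `C₃` part the optimal member's non-surjectivity would need the odd-degree
  transport of `E[2]`; the assembly file keys the `C₃` part at `W` itself instead, where clause (b) is print anyway.)

References: [Lim2017FineSelmer] Thm. 3.5, Lemma 3.2; [FerreroWashington1979]; [CoatesSujatha2005] statement (A), Thm. 3.4;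
[DokchitserDokchitserMathZ2012] Thm. (1); [GreenbergLNM1716] §1 p. 60; MEMO-7 Props. 2.3/2.4 (HOME); the tree files of seats
addL2x GEN 9 (`…AdditiveKatoFineConjAAbelianTwoDivision`), k4-w1 (`…FineSelmerConjAAtTwoAdditivePotGoodHeart`).
-/

set_option autoImplicit false
set_option linter.dupNamespace false

noncomputable section

open scoped Classical MatrixGroups ModularForm NumberField
open CongruenceSubgroup WeierstrassCurve Field IsDedekindDomain
open Literature.NumberTheory.GaloisRepresentations
open Literature.NumberTheory.EllipticCurves Literature.NumberTheory.EllipticCurves.ModularForms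
open Literature.NumberTheory.EllipticCurves.Rank1Residual
open Literature.NumberTheory.EllipticCurves.Greenberg1999
open Literature.NumberTheory.IwasawaTheory
open Summit.BirchSwinnertonDyer.Rank1Residual Summit.BirchSwinnertonDyer.Rank1Residual.X5
open Summit.BirchSwinnertonDyer.BirchSwinnertonDyer.Theses.ByReductionTypeAtTwo

namespace Summit.BirchSwinnertonDyer.BirchSwinnertonDyer.Theorems.SteinbergFibreAtTwo

/-! ## §1 (A₂) at one curve with `ρ̄₂` not onto -/

/-- **Statement (A) at `2` in `Sel₀[2]`-form for every elliptic `W/ℚ` with `ρ̄_{W,2}` NOT onto, from Lim 2017 Thm. 3.5 at `2`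
and Ferrero–Washington BY NAME**: `ℚ(E[2])` is abelian (`not_isAbelianGalois_divisionField_two_iff_hasSurjectiveModNGaloisRep`),
so `AddKatoTwo.conjA_two_of_isAbelianGalois_divisionField_two` gives a fine Selmer dual datum finitely generated over `ℤ₂`, whence
`Sel₀(E/ℚ_∞, E[2^∞])[2]` is finite (`finite_pTorsion_of_fineSelmerDualData_moduleFinite`). Conditional on the two named facts.
[cite: Lim2017FineSelmer, §3 Thm. 3.5 and Lemma 3.2] [cite: FerreroWashington1979, main theorem] [cite: GreenbergLNM1716, §1 p. 60] -/
theorem finite_fineSelmerInfty_twoTorsion_of_not_hasSurjectiveModNGaloisRep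
    (hLim2 : Lim2017.thm35_at_two_fineSelmerDual_moduleFinite_of_classicalMuVanishes_of_le_divisionField_four)
    (hFW : ferreroWashington1979_classicalMuVanishes) (W : WeierstrassCurve ℚ) [W.IsElliptic]
    (hns : ¬ W.HasSurjectiveModNGaloisRep 2) (κ : ZpExtension ℚ 2) (hκ : κ.IsCyclotomic) :
    Set.Finite {s : W.fineSelmerInfty κ | 2 • s = 0} := by
  haveI : IsAbelianGalois ℚ (W.divisionField 2) := by
    by_contra hab
    exact hns ((AddKatoTwo.not_isAbelianGalois_divisionField_two_iff_hasSurjectiveModNGaloisRep W).mp hab)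
  obtain ⟨γ, D, hD⟩ := AddKatoTwo.conjA_two_of_isAbelianGalois_divisionField_two hLim2 hFW W κ hκ
  exact IwasawaModuleFinitePadicInt.finite_pTorsion_of_fineSelmerDualData_moduleFinite W κ D hD

/-! ## §2 The habitat forms consumed by the `μ`-doors -/

/-- **The (A₂-C₃) binder of `…OrdKatoHalfAtTwoIsoIrrMuDoor` VERBATIM, from Lim@2 + Ferrero–Washington by name** (the good-ordinary
and irreducibility guards are idle). [cite: Lim2017FineSelmer, §3 Thm. 3.5 and Lemma 3.2] [cite: FerreroWashington1979, main theorem] -/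
theorem conjATwo_C3_habitat
    (hLim2 : Lim2017.thm35_at_two_fineSelmerDual_moduleFinite_of_classicalMuVanishes_of_le_divisionField_four)
    (hFW : ferreroWashington1979_classicalMuVanishes) :
    ∀ (W : WeierstrassCurve ℚ) [W.IsElliptic] [W.IsGloballyMinimal],
      GoodOrd W 2 → W.HasIrreducibleModPGaloisRep 2 → ¬ W.HasSurjectiveModNGaloisRep 2 →
      ∀ κ : ZpExtension ℚ 2, κ.IsCyclotomic → Set.Finite {s : W.fineSelmerInfty κ | 2 • s = 0} :=
  fun W _ _ _ _ hns κ hκ ↦ finite_fineSelmerInfty_twoTorsion_of_not_hasSurjectiveModNGaloisRep hLim2 hFW W hns κ hκ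

/-- **An isogenous member of an `E[2]`-REDUCIBLE curve has `ρ̄₂` not onto**: reducibility of `E[2]` passes along `ℚ`-isogenies
(`Rank1Residual.not_hasIrreducibleModPGaloisRep_of_isIsogenous`) and a surjective `ρ̄₂` is irreducible (Serre §4).
[cite: Serre1972, §4] -/
theorem not_hasSurjectiveModNGaloisRep_two_of_isIsogenous_of_not_irreducible (W : WeierstrassCurve ℚ) [W.IsElliptic]
    (hred : ¬ W.HasIrreducibleModPGaloisRep 2) {W₀ : WeierstrassCurve ℚ} [W₀.IsElliptic]
    (hiso : WeierstrassCurve.IsIsogenous W W₀) : ¬ W₀.HasSurjectiveModNGaloisRep 2 := by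
  haveI : NeZero ((2 : ℕ) : ℚ) := ⟨by norm_num⟩
  intro hs
  exact Rank1Residual.not_hasIrreducibleModPGaloisRep_of_isIsogenous hiso hred
    (hasIrreducibleModPGaloisRep_of_hasSurjectiveModNGaloisRep W₀ 2 hs)

/-- **The (A₂-opt) binder of `…OrdKatoHalfAtTwoIsoOptimalMemberMuDoor` RESTRICTED TO `E[2]`-REDUCIBLE curves, from Lim@2 +
Ferrero–Washington by name**: for reducible `W` and any isogenous `W₀` (lattice-optimal or not), `Sel₀(W₀/ℚ_∞)[2]` is finite.
[cite: Lim2017FineSelmer, §3 Thm. 3.5 and Lemma 3.2] [cite: FerreroWashington1979, main theorem] -/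
theorem conjATwo_reducible_optimal_habitat
    (hLim2 : Lim2017.thm35_at_two_fineSelmerDual_moduleFinite_of_classicalMuVanishes_of_le_divisionField_four)
    (hFW : ferreroWashington1979_classicalMuVanishes) :
    ∀ (W : WeierstrassCurve ℚ) [W.IsElliptic] [W.IsGloballyMinimal],
      ¬ W.HasCM → GoodOrd W 2 → ¬ W.HasIrreducibleModPGaloisRep 2 →
      ∀ (W₀ : WeierstrassCurve ℚ) [W₀.IsElliptic] [W₀.IsGloballyMinimal] {N₀ : ℕ} [NeZero N₀]
        (D₀ : ModularParametrizationData W₀ N₀), WeierstrassCurve.IsIsogenous W W₀ →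
        (∀ z ∈ D₀.L.lattice, ∃ w ∈ periodLattice D₀.f, z = D₀.c * w) →
        ∀ κ : ZpExtension ℚ 2, κ.IsCyclotomic → Set.Finite {s : W₀.fineSelmerInfty κ | 2 • s = 0} := by
  intro W _ _ _ _ hred W₀ _ _ N₀ _ D₀ hiso _ κ hκ
  exact finite_fineSelmerInfty_twoTorsion_of_not_hasSurjectiveModNGaloisRep hLim2 hFW W₀
    (not_hasSurjectiveModNGaloisRep_two_of_isIsogenous_of_not_irreducible W hred hiso) κ hκ

end Summit.BirchSwinnertonDyer.BirchSwinnertonDyer.Theorems.SteinbergFibreAtTwo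

end
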